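import Mathlib
import Summits.Ventures.HodgeRepro.Tier4.Common.KTypeSpace
import Summits.Ventures.HodgeRepro.Tier4.Common.SettingOfData
import Summits.Ventures.HodgeRepro.Tier4.Line4.MaximalFamilyClosed
import Summits.Ventures.HodgeRepro.Tier4.Line4.W3OfAdaptedClosed
import Summits.Ventures.HodgeRepro.Tier4.Line4.W3OfRieszType

/-!
# Tier4/Line4/W3OfRieszTypeClosed — the basis-free residual of the L4 wall on `Common.kTypeSpace'`, every clause asked
of the CLOSED constituents only (the F-L4-DENSE repair), and its multiplicity-one form

Blind re-derivation cell `pub-hodge-repro`, Tier 4 «prove the step» (README §9–§10), seat t4-L4-p1 (prover, LINE L4,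
gen 3; F-L4-DENSE S13894).  Tree path `lean/Summits/Ventures/HodgeRepro/Tier4/Line4/W3OfRieszTypeClosed.lean`.

WHAT IS PROVED.  `mixed_two_torus_W3R_of_adapted_closed` = `W3OfAdaptedClosed.mixed_two_torus_W3_of_adapted_closed` at
`Sp := kTypeSpace'`: W3‴'s conclusion from the six per-constituent clauses (`hfin`, `ha`, `hb`, `hvan`, `hadm`, `hJ`),
each quantified over the CLOSED (`IsClosedSub`) non-zero irreducible invariant subspaces — the genuine constituents —
instead of all of them; `mixed_two_torus_W3R_of_equivariant_closed` = the same with `ha`/`hb` replaced by multiplicity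
one (`hmult`, closed-gated) + the four displayed left-`(τ′,K)`-equivariance equations (`W3OfRieszType`).  These are
the statements of record for the wall's residual if F-L4-DENSE is confirmed; otherwise harmless strengthenings of
`W3OfRieszType` / `W3OfRieszTypeEquivariant`.  Nothing of the wall's content is proved.

Nothing here says anything about the status of the Hodge conjecture for CM abelian varieties, which is NOT proved
(HC_CM is NOT proved by anyone in this repository).
-/

set_option autoImplicit false

noncomputable section

namespace Summit.Ventures.HodgeRepro.Tier4.Line4

open Summit.Ventures.HodgeRepro.Tier4.Common Summit.Ventures.HodgeRepro.Tier4.Line1 MeasureTheory NumberField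
open scoped ComplexConjugate

section Closed

variable {k : Type} [Field k] [NumberField k] (W : PlaneData k) [MeasurableSpace (GA W)] [BorelSpace (GA W)]
  (R : RTFData W) (μ : Measure (GA W)) [μ.IsHaarMeasure] [R.μT.IsHaarMeasure] [R.μT'.IsHaarMeasure]
  (DG : Set (GA W)) (fdG : IsFundamentalDomain (rationalPoints W) DG μ) (compG : IsCompact (closure DG))
  (compT : IsCompact (closure R.DT)) (compT' : IsCompact (closure R.DT'))

/-- **The basis-free residual on the repaired space, every clause on the CLOSED constituents only** (F-L4-DENSE):
W3‴'s conclusion from the six per-constituent clauses on `kTypeSpace'`, each asked of the closed non-zero irreducible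
invariant subspaces `U` — the genuine constituents. -/
theorem mixed_two_torus_W3R_of_adapted_closed (hc : Continuous R.chi) (hu : ∀ a, ‖R.chi a‖ = 1)
    (hc' : Continuous R.chi') (hunit' : ∀ t, ‖R.chi' t‖ = 1)
    (q : QuadData k) (g g' : Matrix (Fin 4) (Fin 4) k) (w₀ : InfinitePlace k)
    (eP eM eP' eM' : InfinitePlace k → ℤ)
    (K : Subgroup (GA W)) (hK : IsCompactOpenIn W (finitePart W) K)
    (hfin : ∀ U : Set (GA W → ℂ), (Setting.ofAdelicData W R μ DG fdG compG compT compT').IsIrrNonzero U →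
      IsClosedSub (Setting.ofAdelicData W R μ DG fdG compG compT compT') U →
      FiniteDimensional ℂ (kTypeSpace' W q g g' eP' eM' K (Submodule.span ℂ U)))
    {f₁ f₂ : GA W → ℂ} (h₁ : IsTestFn W f₁) (h₂ : IsTestFn W f₂)
    (ha : ∀ U : Set (GA W → ℂ), (Setting.ofAdelicData W R μ DG fdG compG compT compT').IsIrrNonzero U →
      IsClosedSub (Setting.ofAdelicData W R μ DG fdG compG compT compT') U →
      ∃ a : ℂ, ∀ ψ ∈ kTypeSpace' W q g g' eP' eM' K (Submodule.span ℂ U),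
        rightRegular W μ (RTF.cj f₁) (fun x => conj (ψ x)) = fun x => a * conj (ψ x))
    (hb : ∀ U : Set (GA W → ℂ), (Setting.ofAdelicData W R μ DG fdG compG compT compT').IsIrrNonzero U →
      IsClosedSub (Setting.ofAdelicData W R μ DG fdG compG compT compT') U →
      ∃ b : ℂ, ∀ ψ ∈ kTypeSpace' W q g g' eP' eM' K (Submodule.span ℂ U),
        rightRegular W μ (RTF.refl f₂) (fun x => conj (ψ x)) = fun x => b * conj (ψ x))
    (hvan : ∀ U : Set (GA W → ℂ), (Setting.ofAdelicData W R μ DG fdG compG compT compT').IsIrrNonzero U →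
      IsClosedSub (Setting.ofAdelicData W R μ DG fdG compG compT compT') U →
      ∀ ψ ∈ U, (∀ w ∈ kTypeSpace' W q g g' eP' eM' K (Submodule.span ℂ U),
        (Setting.ofAdelicData W R μ DG fdG compG compT compT').inner ψ w = 0) →
        rightRegular W μ (RTF.cj f₁) (fun x => conj (ψ x)) = fun _ => 0)
    (hadm : ∀ U : Set (GA W → ℂ), (Setting.ofAdelicData W R μ DG fdG compG compT compT').IsIrrNonzero U →
      IsClosedSub (Setting.ofAdelicData W R μ DG fdG compG compT compT') U →
      ∀ a : ℂ, a ≠ 0 →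
      (∃ ψ ∈ kTypeSpace' W q g g' eP' eM' K (Submodule.span ℂ U), ψ ≠ 0 ∧
        rightRegular W μ (RTF.cj f₁) (fun x => conj (ψ x)) = fun x => a * conj (ψ x)) →
      IsAdmissibleS W (Setting.ofAdelicData W R μ DG fdG compG compT compT') q g g' w₀ eP eM eP' eM'
        (Submodule.span ℂ U))
    (hJ : R.Jc ((Setting.ofAdelicData W R μ DG fdG compG compT compT').conv f₁ f₂) ≠ 0) :
    ∃ V₀ : Submodule ℂ (GA W → ℂ),
      IsAdmissibleS W (Setting.ofAdelicData W R μ DG fdG compG compT compT') q g g' w₀ eP eM eP' eM' V₀ ∧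
      ∃ K₀ : Subgroup (GA W), IsCompactOpenIn W (finitePart W) K₀ ∧
        FiniteDimensional ℂ (kTypeSpace' W q g g' eP' eM' K₀ V₀) ∧
        ∃ f : GA W → ℂ, IsRieszVectorOn R μ DG (kTypeSpace' W q g g' eP' eM' K₀ V₀) f ∧
          periodLin W R.μT R.DT R.chi (restrictTo W (torusT W) f) ≠ 0 :=
  mixed_two_torus_W3_of_adapted_closed W R μ DG fdG compG compT compT' (fun K V => kTypeSpace' W q g g' eP' eM' K V)
    (fun K V => kTypeSpace'_le W q g g' eP' eM' K V) hc hu hc' hunit' q g g' w₀ eP eM eP' eM' K hK hfin h₁ h₂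
    ha hb hvan hadm hJ

/-- **W3‴ from multiplicity one + left-`(τ′,K)`-equivariant test functions, on the CLOSED constituents** (the clauses
`ha`/`hb` of `mixed_two_torus_W3R_of_adapted_closed` replaced by `hmult` + the `T′`/`K`-equivariance of `f₁` and
`cj (refl f₂)`). -/
theorem mixed_two_torus_W3R_of_equivariant_closed (hc : Continuous R.chi) (hu : ∀ a, ‖R.chi a‖ = 1)
    (hc' : Continuous R.chi') (hunit' : ∀ t, ‖R.chi' t‖ = 1)
    (q : QuadData k) (g g' : Matrix (Fin 4) (Fin 4) k) (w₀ : InfinitePlace k)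
    (eP eM eP' eM' : InfinitePlace k → ℤ)
    (K : Subgroup (GA W)) (hK : IsCompactOpenIn W (finitePart W) K)
    (hfin : ∀ U : Set (GA W → ℂ), (Setting.ofAdelicData W R μ DG fdG compG compT compT').IsIrrNonzero U →
      IsClosedSub (Setting.ofAdelicData W R μ DG fdG compG compT compT') U →
      FiniteDimensional ℂ (kTypeSpace' W q g g' eP' eM' K (Submodule.span ℂ U)))
    (hmult : ∀ U : Set (GA W → ℂ), (Setting.ofAdelicData W R μ DG fdG compG compT compT').IsIrrNonzero U →
      IsClosedSub (Setting.ofAdelicData W R μ DG fdG compG compT compT') U →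
      ∃ v : GA W → ℂ, kTypeSpace' W q g g' eP' eM' K (Submodule.span ℂ U) ≤ Submodule.span ℂ {v})
    {f₁ f₂ : GA W → ℂ} (h₁ : IsTestFn W f₁) (h₂ : IsTestFn W f₂)
    (h₁T' : ∀ (w : InfinitePlace k) (κ : GA W), κ ∈ localTorusAt' W w → ∀ y,
      f₁ (κ⁻¹ * y) = weightAt' W q w g g' 0 κ ^ eP' w * weightAt' W q w g g' 1 κ ^ eM' w * f₁ y)
    (h₁K : ∀ κ ∈ K, ∀ y, f₁ (κ⁻¹ * y) = f₁ y)
    (h₂T' : ∀ (w : InfinitePlace k) (κ : GA W), κ ∈ localTorusAt' W w → ∀ y,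
      RTF.cj (RTF.refl f₂) (κ⁻¹ * y) =
        weightAt' W q w g g' 0 κ ^ eP' w * weightAt' W q w g g' 1 κ ^ eM' w * RTF.cj (RTF.refl f₂) y)
    (h₂K : ∀ κ ∈ K, ∀ y, RTF.cj (RTF.refl f₂) (κ⁻¹ * y) = RTF.cj (RTF.refl f₂) y)
    (hvan : ∀ U : Set (GA W → ℂ), (Setting.ofAdelicData W R μ DG fdG compG compT compT').IsIrrNonzero U →
      IsClosedSub (Setting.ofAdelicData W R μ DG fdG compG compT compT') U →
      ∀ ψ ∈ U, (∀ w ∈ kTypeSpace' W q g g' eP' eM' K (Submodule.span ℂ U),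
        (Setting.ofAdelicData W R μ DG fdG compG compT compT').inner ψ w = 0) →
        rightRegular W μ (RTF.cj f₁) (fun x => conj (ψ x)) = fun _ => 0)
    (hadm : ∀ U : Set (GA W → ℂ), (Setting.ofAdelicData W R μ DG fdG compG compT compT').IsIrrNonzero U →
      IsClosedSub (Setting.ofAdelicData W R μ DG fdG compG compT compT') U →
      ∀ a : ℂ, a ≠ 0 →
      (∃ ψ ∈ kTypeSpace' W q g g' eP' eM' K (Submodule.span ℂ U), ψ ≠ 0 ∧
        rightRegular W μ (RTF.cj f₁) (fun x => conj (ψ x)) = fun x => a * conj (ψ x)) →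
      IsAdmissibleS W (Setting.ofAdelicData W R μ DG fdG compG compT compT') q g g' w₀ eP eM eP' eM'
        (Submodule.span ℂ U))
    (hJ : R.Jc ((Setting.ofAdelicData W R μ DG fdG compG compT compT').conv f₁ f₂) ≠ 0) :
    ∃ V₀ : Submodule ℂ (GA W → ℂ),
      IsAdmissibleS W (Setting.ofAdelicData W R μ DG fdG compG compT compT') q g g' w₀ eP eM eP' eM' V₀ ∧
      ∃ K₀ : Subgroup (GA W), IsCompactOpenIn W (finitePart W) K₀ ∧
        FiniteDimensional ℂ (kTypeSpace' W q g g' eP' eM' K₀ V₀) ∧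
        ∃ f : GA W → ℂ, IsRieszVectorOn R μ DG (kTypeSpace' W q g g' eP' eM' K₀ V₀) f ∧
          periodLin W R.μT R.DT R.chi (restrictTo W (torusT W) f) ≠ 0 := by
  set S := Setting.ofAdelicData W R μ DG fdG compG compT compT' with hS
  -- the span of a non-zero irreducible invariant subspace is an invariant subspace
  have hspanInv : ∀ U : Set (GA W → ℂ), S.IsIrrNonzero U →
      S.IsInvariantSubspace ((Submodule.span ℂ U : Submodule ℂ (GA W → ℂ)) : Set (GA W → ℂ)) := by
    intro U hU
    obtain ⟨ψ, hψ, -⟩ := hU.2.2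
    rw [coe_span_eq_of_isInvariantSubspace S hU.1 ⟨ψ, hψ⟩]
    exact hU.1
  have h₂' : IsTestFn W (RTF.cj (RTF.refl f₂)) :=
    ⟨(RTF.IsTest.cj (RTF.IsTest.refl ⟨h₂.1, h₂.2⟩)).cont, (RTF.IsTest.cj (RTF.IsTest.refl ⟨h₂.1, h₂.2⟩)).compact⟩
  refine mixed_two_torus_W3R_of_adapted_closed W R μ DG fdG compG compT compT' hc hu hc' hunit' q g g' w₀ eP eM eP' eM' K hK
    hfin h₁ h₂ ?_ ?_ hvan hadm hJ
  · intro U hU hUc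
    exact exists_scalar_conj_of_le_span_singleton_riesz W R μ DG fdG compG compT compT' q g g' eP' eM' K
      (Submodule.span ℂ U) (hspanInv U hU) h₁ h₁T' h₁K (hmult U hU hUc)
  · intro U hU hUc
    have := exists_scalar_conj_of_le_span_singleton_riesz W R μ DG fdG compG compT compT' q g g' eP' eM' K
      (Submodule.span ℂ U) (hspanInv U hU) h₂' h₂T' h₂K (hmult U hU hUc)
    rw [cj_cj] at this
    exact this

end Closed

end Summit.Ventures.HodgeRepro.Tier4.Line4

end
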